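import Literature.Computability.MetaComplexity.BlockClosureFreeness
import Literature.Computability.MetaComplexity.BinaryPigeonholeResLinRank
import Literature.Computability.MetaComplexity.BinaryPigeonholeUnsat
import Literature.Computability.MetaComplexity.ResLinProverDelayer
import Literature.Computability.MetaComplexity.ResLinTreeLikeCompleteness
import HarnessLib

/-!
# Tree-like Res(⊕) refutations of the binary pigeonhole principle have size `≥ 2^{n/4}` (Efremenko–Garlík–Itsykson 2024, Thm 5.8)

**Theorem 5.8** of Efremenko–Garlík–Itsykson [STOC 2024 = ECCC TR23-187, §5.2]: *the size of any
tree-like Res(⊕) refutation of `BPHPᵐ_{2^ℓ}` is at least `2^{2^{ℓ−2}}` (= `2^{n/4}`, `n = 2^ℓ`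
holes).* We prove (`two_pow_le_length_bphp_treeLike`): for `ℓ ≥ 3` and every `m`, every TREE-LIKE
Res(⊕) refutation (resolution rule + SEMANTIC weakening, every line used as a premise at most once)
of `bphpCNF m ℓ` has at least `2^(2^(ℓ-2) + 1)` lines.

Proof = the printed Prover–Delayer strategy, run on the tree's CANONICAL closure
(`BlockCanonicalClosure.lean`, `BlockClosureFreeness.lean`) and fed into the game lemma
(`ResLinProverDelayer.lean`). Delayer keeps the board LOCALLY CONSISTENT (`LocConsistent`: a solution
whose pigeons of the closure `Cl` of the board's forms sit in pairwise distinct holes). His rule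
(`bphpDelayer`): answer `*` exactly when the potential `P = |Cl| + dim W[∖Cl]` (`clPotential`) goes
UP by the new form — then the closure does not move and the new form is independent even after
freezing the closure's variables (`inf_sup_coordSub_le_of_clPotential_eq_succ`), so BOTH values keep
local consistency (EGI Lemma 5.3, `locConsistent_cons_of_potential_eq_succ`); otherwise answer a value
keeping local consistency, which exists as long as the new closure has `≤ 2^{ℓ−2}` pigeons (EGI Lemma
5.4, here by the deterministic re-placement of `BinaryPigeonholeResLinRank.lean`:
`exists_locConsistent_cons`). The coins earned EQUAL the potential (`coins_eq_boardPotential`: "the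
quantity `|Cl(F)| + dim⟨F[∖Cl(F)]⟩` records the number of coins"), the board stays locally consistent
while `|Cl| ≤ 2^{ℓ−2}` (`locConsistent_of_conform`), a locally consistent board contradicts no clause
(EGI Lemma 5.7, `not_contradicts_of_locConsistent`), so when the game ends `coins = P ≥ |Cl| ≥
2^{ℓ−2} + 1` (`guarantees_bphpDelayer`).

Differences from print: (a) `ℓ ≥ 3` (the separating bit must avoid two pivots, as in the rank file;
print `ℓ > 1`); (b) the bound is `2^(2^(ℓ-2)+1)`, one doubling better than the printed `2^{2^{ℓ−2}}`
(Delayer gives up only when `|Cl| > 2^{ℓ−2}`); (c) Lemma 5.4 is replaced by the deterministic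
re-placement; (d) the closure is the least maximiser of the deficiency (= the printed `Cl` by EGI Lemma
4.4), its accounting is `BlockCanonicalClosure.lean`. REPRODUCTION; no new mathematics.

## References

* K. Efremenko, M. Garlík, D. Itsykson, *Lower bounds for regular resolution over parities*, STOC 2024
  (SIAM J. Comput. 2025) = ECCC TR23-187, §5.2: Lemma 5.6 (the game), Lemma 5.7, Theorem 5.8 and its
  proof (the potential `|Cl(F)| + dim⟨F[∖Cl(F)]⟩`) [EfremenkoGarlikItsykson2024].
-/

namespace Literature.Computability.MetaComplexity

open _root_.Computability Complexity Finset Module ProverDelayer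

section BPHPGame

variable (ℓ : ℕ)

/-! ### The board: its form span, canonical closure, potential -/

/-- The span `W = ⟨L(Φ)⟩` of the linear forms on the board `Φ`. [Efremenko–Garlík–Itsykson 2024, §5.2
("Let F be … the set of linear forms written on the board")] [cite: EfremenkoGarlikItsykson2024, Theorem 5.8] -/
noncomputable def boardSpan (Φ : List LinLit) : Submodule (ZMod 2) (ℕ → ZMod 2) :=
  Submodule.span (ZMod 2) (LinClause.forms Φ.toFinset)

/-- The canonical closure `Cl(F)` of the forms on the board (pigeons = blocks of `ℓ` bits).
[Efremenko–Garlík–Itsykson 2024, §5.2] [cite: EfremenkoGarlikItsykson2024, Theorem 5.8] -/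
noncomputable def boardClosure (Φ : List LinLit) : Finset ℕ := canClosure ℓ (boardSpan Φ)

/-- The potential `|Cl(F)| + dim⟨F[∖Cl(F)]⟩` of the board. [Efremenko–Garlík–Itsykson 2024, Thm 5.8
(proof)] [cite: EfremenkoGarlikItsykson2024, Theorem 5.8] -/
noncomputable def boardPotential (Φ : List LinLit) : ℕ := clPotential ℓ (boardSpan Φ)

/-- LOCAL CONSISTENCY of the board: a solution sending the pigeons of the closure to pairwise
distinct holes. [Efremenko–Garlík–Itsykson 2024, §5 ("locally injective solution")]
[cite: EfremenkoGarlikItsykson2024, §5 (locally consistent systems)] -/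
def LocConsistent (Φ : List LinLit) : Prop :=
  ∃ σ : ℕ → Bool, (∀ e ∈ Φ, LinLit.eval σ e = true) ∧
    Set.InjOn (holeOf ℓ σ) (↑(boardClosure ℓ Φ) : Set ℕ)

/-- **The Delayer of Efremenko–Garlík–Itsykson for `BPHP`** [EGI24, Thm 5.8 (proof)]: answer `*`
exactly when the potential goes up by the asked form; otherwise answer a value keeping the board
locally consistent if there is one. [cite: EfremenkoGarlikItsykson2024, Theorem 5.8] -/
noncomputable def bphpDelayer : Strategy := fun Φ f => by
  classical
  exact if boardPotential ℓ ((f, false) :: Φ) = boardPotential ℓ Φ + 1 then none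
    else if LocConsistent ℓ ((f, false) :: Φ) then some false
    else if LocConsistent ℓ ((f, true) :: Φ) then some true else some false

variable {ℓ}

/-- The board's form span is finite-dimensional. [folklore] -/
instance boardSpan_finite (Φ : List LinLit) : Module.Finite (ZMod 2) (boardSpan Φ) :=
  Module.Finite.span_of_finite (ZMod 2) (Set.finite_range _)

/-- The forms of `(f = a) :: Φ` are those of `Φ` and `f` (the value `a` plays no role). [folklore] -/
theorem forms_toFinset_cons (f : Finset ℕ) (a : Bool) (Φ : List LinLit) :
    LinClause.forms ((f, a) :: Φ).toFinset = insert (linFormVec f) (LinClause.forms Φ.toFinset) := by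
  ext v
  simp only [LinClause.mem_forms_iff, List.mem_toFinset, List.mem_cons, Set.mem_insert_iff]
  constructor
  · rintro ⟨l, rfl | hl, hv⟩
    · exact Or.inl hv.symm
    · exact Or.inr ⟨l, hl, hv⟩
  · rintro (rfl | ⟨l, hl, hv⟩)
    · exact ⟨(f, a), Or.inl rfl, rfl⟩
    · exact ⟨l, Or.inr hl, hv⟩

/-- The span of `(f = a) :: Φ`. [folklore] -/
theorem boardSpan_cons (f : Finset ℕ) (a : Bool) (Φ : List LinLit) :
    boardSpan ((f, a) :: Φ) = (ZMod 2) ∙ linFormVec f ⊔ boardSpan Φ := by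
  unfold boardSpan
  rw [forms_toFinset_cons, Submodule.span_insert]

/-- The span does not depend on the value written next to the new form. [folklore] -/
theorem boardSpan_cons_eq (f : Finset ℕ) (a b : Bool) (Φ : List LinLit) :
    boardSpan ((f, a) :: Φ) = boardSpan ((f, b) :: Φ) := by
  rw [boardSpan_cons, boardSpan_cons]

/-- The span grows along the board. [folklore] -/
theorem boardSpan_le_cons (e : LinLit) (Φ : List LinLit) : boardSpan Φ ≤ boardSpan (e :: Φ) := by
  obtain ⟨f, a⟩ := e
  rw [boardSpan_cons]
  exact le_sup_right

/-- The new form lies in the new span. [folklore] -/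
theorem linFormVec_mem_boardSpan_cons (f : Finset ℕ) (a : Bool) (Φ : List LinLit) :
    linFormVec f ∈ boardSpan ((f, a) :: Φ) := by
  rw [boardSpan_cons]
  exact Submodule.mem_sup_left (Submodule.mem_span_singleton_self _)

/-- One new form raises the dimension by at most one. [folklore] -/
theorem finrank_boardSpan_cons_le (e : LinLit) (Φ : List LinLit) :
    finrank (ZMod 2) (boardSpan (e :: Φ)) ≤ finrank (ZMod 2) (boardSpan Φ) + 1 := by
  have h := linClauseRank_insert_le e Φ.toFinset
  rw [linClauseRank_eq, linClauseRank_eq, ← List.toFinset_cons] at h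
  exact h

/-- Every board is supported in finitely many blocks. [folklore] -/
theorem exists_boardSupport (hℓ : 0 < ℓ) (Φ : List LinLit) :
    ∃ B : Finset ℕ, boardSpan Φ ≤ coordSub (blockVars ℓ B) := by
  classical
  set M : ℕ := (Φ.toFinset.biUnion (fun e => e.1)).sup (fun v => v / ℓ) + 1 with hM
  refine ⟨Finset.range M, span_forms_le_coordSub hℓ fun e he v hv => ?_⟩
  have h1 : v / ℓ < M :=
    Nat.lt_succ_of_le (Finset.le_sup (f := fun v => v / ℓ) (Finset.mem_biUnion.2 ⟨e, he, hv⟩))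
  rwa [Nat.div_lt_iff_lt_mul hℓ] at h1

/-- The empty board: span `⊥`, closure `∅`, potential `0`. [folklore] -/
theorem boardSpan_nil : boardSpan [] = ⊥ := by
  unfold boardSpan
  rw [List.toFinset_nil, LinClause.forms_empty, Submodule.span_empty]

/-- The potential of the empty board is `0`. [folklore] -/
theorem boardPotential_nil (hℓ : 0 < ℓ) : boardPotential ℓ [] = 0 := by
  unfold boardPotential
  rw [boardSpan_nil]
  have h := clPotential_le_finrank (ℓ := ℓ) (W := (⊥ : Submodule (ZMod 2) (ℕ → ZMod 2)))
    (B := ∅) bot_le hℓ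
  rw [finrank_bot] at h
  exact Nat.le_zero.1 h

/-- The closure of the empty board is empty. [folklore] -/
theorem boardClosure_nil (hℓ : 0 < ℓ) : boardClosure ℓ [] = ∅ := by
  have h1 : (boardClosure ℓ []).card ≤ boardPotential ℓ [] := card_canClosure_le_clPotential
  rw [boardPotential_nil hℓ, Nat.le_zero, Finset.card_eq_zero] at h1
  exact h1

/-! ### Unit steps of the potential along the board -/

/-- The potential is monotone along the board and rises by at most one per form.
[Efremenko–Garlík–Itsykson 2024, Thm 5.8 (proof)] [cite: EfremenkoGarlikItsykson2024, Theorem 5.8] -/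
theorem boardPotential_cons_le (hℓ : 0 < ℓ) (e : LinLit) (Φ : List LinLit) :
    boardPotential ℓ Φ ≤ boardPotential ℓ (e :: Φ) ∧
      boardPotential ℓ (e :: Φ) ≤ boardPotential ℓ Φ + 1 := by
  obtain ⟨B, hB'⟩ := exists_boardSupport hℓ (e :: Φ)
  exact ⟨clPotential_mono hℓ (boardSpan_le_cons e Φ) hB',
    clPotential_le_succ hℓ (boardSpan_le_cons e Φ) hB' (finrank_boardSpan_cons_le e Φ)⟩

/-- The closure is monotone along the board. [Alekseev–Itsykson 2025, Lemma 2.5]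
[cite: EfremenkoGarlikItsykson2024, Theorem 5.8] -/
theorem boardClosure_subset_cons (hℓ : 0 < ℓ) (e : LinLit) (Φ : List LinLit) :
    boardClosure ℓ Φ ⊆ boardClosure ℓ (e :: Φ) := by
  obtain ⟨B, hB'⟩ := exists_boardSupport hℓ (e :: Φ)
  exact canClosure_mono hℓ (boardSpan_le_cons e Φ) hB'

/-- THE STAR CASE: if the potential goes up, the closure does not move, the dimension goes up, and
the new form is independent of the old forms together with all variables of the closure.
[Efremenko–Garlík–Itsykson 2024, Thm 5.8 (proof, second bullet), Lemma 5.3]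
[cite: EfremenkoGarlikItsykson2024, Lemma 5.3] -/
theorem star_case (hℓ : 0 < ℓ) (f : Finset ℕ) (a : Bool) (Φ : List LinLit)
    (hP : boardPotential ℓ ((f, a) :: Φ) = boardPotential ℓ Φ + 1) :
    boardClosure ℓ ((f, a) :: Φ) = boardClosure ℓ Φ ∧
      linFormVec f ∉ boardSpan Φ ⊔ coordSub (blockVars ℓ (boardClosure ℓ Φ)) := by
  obtain ⟨B, hB'⟩ := exists_boardSupport hℓ ((f, a) :: Φ)
  have hle := boardSpan_le_cons (f, a) Φ
  have hdim := finrank_boardSpan_cons_le (f, a) Φ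
  refine ⟨canClosure_eq_of_clPotential_eq_succ hℓ hle hB' hdim hP, fun hmem => ?_⟩
  have hind := inf_sup_coordSub_le_of_clPotential_eq_succ hℓ hle hB' hdim hP
  -- `f ∈ W' ∩ (W + 𝔽₂^{Cl}) ≤ W`, so the span did not grow: contradiction with the potential
  have hfW : linFormVec f ∈ boardSpan Φ :=
    hind (Submodule.mem_inf.2 ⟨linFormVec_mem_boardSpan_cons f a Φ, hmem⟩)
  have heq : boardSpan ((f, a) :: Φ) = boardSpan Φ := by
    apply le_antisymm _ hle
    rw [boardSpan_cons]
    exact sup_le ((Submodule.span_singleton_le_iff_mem _ _).2 hfW) le_rfl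
  unfold boardPotential at hP
  rw [heq] at hP
  omega

/-! ### Local consistency is maintained -/

/-- The empty board is locally consistent. [Efremenko–Garlík–Itsykson 2024, §5 (example 1)]
[cite: EfremenkoGarlikItsykson2024, §5 (locally consistent systems)] -/
theorem locConsistent_nil (hℓ : 0 < ℓ) : LocConsistent ℓ [] := by
  refine ⟨fun _ => false, by simp, ?_⟩
  rw [boardClosure_nil hℓ]
  simp

/-- **Star step** [Efremenko–Garlík–Itsykson 2024, Lemma 5.3]: if the potential goes up with the form
`f`, then BOTH equations `f = a` keep the board locally consistent — freeze the closure's variables at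
a locally injective solution; `f` is not implied by the old forms and these frozen values, so it can
still take either value. [cite: EfremenkoGarlikItsykson2024, Lemma 5.3] -/
theorem locConsistent_cons_of_potential_eq_succ (hℓ : 0 < ℓ) {f : Finset ℕ} {Φ : List LinLit}
    (hP : boardPotential ℓ ((f, false) :: Φ) = boardPotential ℓ Φ + 1) (hΦ : LocConsistent ℓ Φ)
    (a : Bool) : LocConsistent ℓ ((f, a) :: Φ) := by
  classical
  have hPa : boardPotential ℓ ((f, a) :: Φ) = boardPotential ℓ Φ + 1 := by
    unfold boardPotential at hP ⊢; rwa [boardSpan_cons_eq f a false]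
  obtain ⟨hCl, hind⟩ := star_case hℓ f a Φ hPa
  obtain ⟨σ, hσΦ, hinj⟩ := hΦ
  set C := boardClosure ℓ Φ with hC
  -- the frozen system: `Φ` together with the unit equations `x_v = σ v`, `v` in the closure blocks
  set G : Finset LinLit := Φ.toFinset ∪ (blockVars ℓ C).image (fun v => (({v} : Finset ℕ), σ v))
    with hG
  have hσG : ∀ e ∈ G, LinLit.eval σ e = true := by
    intro e he
    rcases Finset.mem_union.1 he with he | he
    · exact hσΦ e (List.mem_toFinset.1 he)
    · obtain ⟨v, -, rfl⟩ := Finset.mem_image.1 he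
      rw [LinLit.eval_singleton]; simp
  -- `f = a` is consistent with `G`
  have hnot : ¬ ∀ τ : ℕ → Bool, (∀ e ∈ G, LinLit.eval τ e = true) → LinLit.eval τ (f, !a) = true := by
    intro himp
    apply hind
    have hspan := linFormVec_mem_span_of_imp hσG himp
    -- `⟨L(G)⟩ ≤ W + 𝔽₂^{blockVars C}`
    have hle : Submodule.span (ZMod 2) (LinClause.forms G) ≤
        boardSpan Φ ⊔ coordSub (blockVars ℓ C) := by
      rw [Submodule.span_le]
      intro w hw
      obtain ⟨e, he, rfl⟩ := LinClause.mem_forms_iff.1 hw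
      rcases Finset.mem_union.1 he with he | he
      · exact Submodule.mem_sup_left (Submodule.subset_span (LinClause.mem_forms_iff.2 ⟨e, he, rfl⟩))
      · obtain ⟨v, hv, rfl⟩ := Finset.mem_image.1 he
        refine Submodule.mem_sup_right ?_
        intro i hi
        have : i ≠ v := fun h => hi (h ▸ hv)
        simp [linFormVec, this]
    exact hle hspan
  push Not at hnot
  obtain ⟨τ, hτG, hτf⟩ := hnot
  refine ⟨τ, ?_, ?_⟩
  · intro e he
    rcases List.mem_cons.1 he with rfl | he
    · have h1 := linLit_eval_not τ f a
      rw [h1] at hτf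
      revert hτf; cases LinLit.eval τ (f, a) <;> simp
    · exact hτG e (Finset.mem_union_left _ (List.mem_toFinset.2 he))
  · -- `τ` agrees with `σ` on the closure blocks, and the closure did not move
    rw [hCl]
    have hagree : ∀ x ∈ C, holeOf ℓ τ x = holeOf ℓ σ x := by
      intro x hx
      funext j
      have hv : x * ℓ + j ∈ blockVars ℓ C := by
        rw [mem_blockVars hℓ, div_block_eq hℓ j.isLt]; exact hx
      have := hτG _ (Finset.mem_union_right _ (Finset.mem_image.2 ⟨_, hv, rfl⟩))
      rw [LinLit.eval_singleton] at this
      simpa [holeOf] using this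
    intro x hx y hy hxy
    rw [Finset.mem_coe] at hx hy
    rw [hagree x hx, hagree y hy] at hxy
    exact hinj hx hy hxy

/-- **No-star step** [Efremenko–Garlík–Itsykson 2024, Lemma 5.4, here by the deterministic
re-placement of `exists_separated_patterns`]: if the board is locally consistent and the closure
after adding the form `f` has at most `2^{ℓ−2}` pigeons, then SOME equation `f = a` keeps the
board locally consistent (`ℓ ≥ 1`). [cite: EfremenkoGarlikItsykson2024, Lemma 5.4] -/
theorem exists_locConsistent_cons (hℓ2 : 2 ≤ ℓ) {f : Finset ℕ} {Φ : List LinLit}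
    (hΦ : LocConsistent ℓ Φ) (hcard : (boardClosure ℓ ((f, false) :: Φ)).card ≤ 2 ^ (ℓ - 2)) :
    ∃ a : Bool, LocConsistent ℓ ((f, a) :: Φ) := by
  classical
  have hℓ : 0 < ℓ := by omega
  obtain ⟨σ, hσΦ, hinj⟩ := hΦ
  set C := boardClosure ℓ Φ with hC
  set C' := boardClosure ℓ ((f, false) :: Φ) with hC'
  have hCC' : C ⊆ C' := boardClosure_subset_cons hℓ (f, false) Φ
  -- freeness outside the old closure
  obtain ⟨p, hfree⟩ := exists_blockFree_canClosure hℓ Φ.toFinset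
  have hσF : ∀ e ∈ Φ.toFinset, LinLit.eval σ e = true := fun e he => hσΦ e (List.mem_toFinset.1 he)
  -- separated patterns for the new pigeons
  set T : Finset ℕ := C' \ C with hTdef
  have hCT : C.card + 2 * T.card ≤ 2 ^ (ℓ - 1) := by
    have h1 : C.card + T.card = C'.card := by
      rw [hTdef, ← Finset.card_union_of_disjoint Finset.disjoint_sdiff, Finset.union_sdiff_of_subset hCC']
    have h2 : (2 : ℕ) ^ (ℓ - 1) = 2 * 2 ^ (ℓ - 2) := by
      rw [← pow_succ']; congr 1; omega
    omega
  obtain ⟨t, htC, htT⟩ := exists_separated_patterns (by omega) p C (holeOf ℓ σ) T hCT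
  -- the targets: the chosen patterns on the blocks of `T`
  let τ : ℕ → Bool := fun v =>
    if v / ℓ ∈ T then t (v / ℓ) ⟨v % ℓ, Nat.mod_lt v hℓ⟩ else σ v
  have hτ : ∀ x ∈ T, ∀ j : Fin ℓ, τ (x * ℓ + j) = t x j := by
    intro x hx j
    simp only [τ, div_block_eq hℓ j.isLt, hx, if_true]
    congr 1
    exact Fin.ext (mod_block_eq j.isLt)
  obtain ⟨σ', hforms, hQblocks, hout⟩ := hfree σ τ
  have hσ'F : ∀ e ∈ Φ.toFinset, LinLit.eval σ' e = true := solves_of_forms_eq hforms hσF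
  -- holes after the move
  have hkept : ∀ q ∈ C, holeOf ℓ σ' q = holeOf ℓ σ q := by
    intro q hq; funext j; exact hQblocks q hq j
  have hnew : ∀ x ∈ T, ∀ j : Fin ℓ, j ≠ p x → holeOf ℓ σ' x j = t x j := by
    intro x hx j hj
    have hxC : x ∉ C := (Finset.mem_sdiff.1 hx).2
    show σ' (x * ℓ + j) = t x j
    rw [hout x hxC j hj, hτ x hx j]
  -- the pigeons of `C'` sit in pairwise distinct holes
  have hinj' : Set.InjOn (holeOf ℓ σ') (↑C' : Set ℕ) := by
    intro q₁ hq₁ q₂ hq₂ heq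
    by_contra hne
    have hcase : ∀ q, q ∈ (↑C' : Set ℕ) → q ∈ C ∨ q ∈ T := by
      intro q hq
      by_cases hqC : q ∈ C
      · exact Or.inl hqC
      · exact Or.inr (Finset.mem_sdiff.2 ⟨hq, hqC⟩)
    rcases hcase q₁ hq₁ with h₁ | h₁ <;> rcases hcase q₂ hq₂ with h₂ | h₂
    · rw [hkept q₁ h₁, hkept q₂ h₂] at heq
      exact hne (hinj (Finset.mem_coe.2 h₁) (Finset.mem_coe.2 h₂) heq)
    · obtain ⟨j, hj, hne'⟩ := htC q₂ h₂ q₁ h₁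
      apply hne'
      rw [← hnew q₂ h₂ j hj, ← heq, hkept q₁ h₁]
    · obtain ⟨j, hj, hne'⟩ := htC q₁ h₁ q₂ h₂
      apply hne'
      rw [← hnew q₁ h₁ j hj, heq, hkept q₂ h₂]
    · obtain ⟨j, hj₁, hj₂, hne'⟩ := htT q₁ h₁ q₂ h₂ hne
      apply hne'
      rw [← hnew q₁ h₁ j hj₁, ← hnew q₂ h₂ j hj₂, heq]
  -- answer `f` by its value at `σ'`
  refine ⟨LinLit.eval σ' (f, true), σ', ?_, ?_⟩
  · intro e he
    rcases List.mem_cons.1 he with rfl | he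
    · cases h : LinLit.eval σ' (f, true)
      · have h1 := LinLit.eval_true_eq_not σ' f
        rw [h] at h1
        revert h1
        cases LinLit.eval σ' (f, false) <;> simp
      · exact h
    · exact hσ'F e (List.mem_toFinset.2 he)
  · have : boardClosure ℓ ((f, LinLit.eval σ' (f, true)) :: Φ) = C' := by
      rw [hC']; unfold boardClosure; rw [boardSpan_cons_eq]
    rw [this]
    exact hinj'

/-- **Invariant**: along every board conforming to the Delayer whose closure has at most `2^{ℓ−2}`
pigeons, the board is locally consistent. [Efremenko–Garlík–Itsykson 2024, Thm 5.8 (proof: "Delayer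
will keep a locally consistent system on the board as long as possible")]
[cite: EfremenkoGarlikItsykson2024, Theorem 5.8] -/
theorem locConsistent_of_conform (hℓ2 : 2 ≤ ℓ) :
    ∀ Φ : List LinLit, Conform (bphpDelayer ℓ) Φ → (boardClosure ℓ Φ).card ≤ 2 ^ (ℓ - 2) →
      LocConsistent ℓ Φ := by
  classical
  have hℓ : 0 < ℓ := by omega
  intro Φ
  induction Φ with
  | nil => intro _ _; exact locConsistent_nil hℓ
  | cons e Φ ih =>
    rintro ⟨hconf, hans⟩ hcard
    obtain ⟨f, a⟩ := e
    have hcardΦ : (boardClosure ℓ Φ).card ≤ 2 ^ (ℓ - 2) :=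
      (Finset.card_le_card (boardClosure_subset_cons hℓ (f, a) Φ)).trans hcard
    have hΦ := ih hconf hcardΦ
    have hcard' : (boardClosure ℓ ((f, false) :: Φ)).card ≤ 2 ^ (ℓ - 2) := by
      unfold boardClosure at hcard ⊢; rwa [boardSpan_cons_eq f false a]
    by_cases hP : boardPotential ℓ ((f, false) :: Φ) = boardPotential ℓ Φ + 1
    · exact locConsistent_cons_of_potential_eq_succ hℓ hP hΦ a
    · -- the Delayer answered a value; it keeps local consistency whenever some value does
      obtain ⟨a₀, ha₀⟩ := exists_locConsistent_cons hℓ2 hΦ hcard'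
      have hδ : bphpDelayer ℓ Φ f = some a := by
        rcases hans with h | h
        · exfalso
          revert h
          unfold bphpDelayer
          simp [hP]
          split_ifs <;> simp
        · exact h
      unfold bphpDelayer at hδ
      simp only [hP, if_false] at hδ
      by_cases h0 : LocConsistent ℓ ((f, false) :: Φ)
      · simp only [h0, if_true, Option.some.injEq] at hδ
        subst hδ; exact h0
      · simp only [h0, if_false] at hδ
        by_cases h1 : LocConsistent ℓ ((f, true) :: Φ)
        · simp only [h1, if_true, Option.some.injEq] at hδ
          subst hδ; exact h1
        · exfalso
          cases a₀
          · exact h0 ha₀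
          · exact h1 ha₀

/-! ### Coins = potential; Lemma 5.7; the guarantee -/

/-- **"The quantity `|Cl(F)| + dim⟨F[∖Cl(F)]⟩` records the number of coins"** [Efremenko–Garlík–
Itsykson 2024, Thm 5.8 (proof)]: along every board conforming to the Delayer, coins = potential.
[cite: EfremenkoGarlikItsykson2024, Theorem 5.8] -/
theorem coins_eq_boardPotential (hℓ : 0 < ℓ) :
    ∀ Φ : List LinLit, Conform (bphpDelayer ℓ) Φ → coins (bphpDelayer ℓ) Φ = boardPotential ℓ Φ := by
  classical
  intro Φ
  induction Φ with
  | nil => intro _; rw [coins_nil, boardPotential_nil hℓ]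
  | cons e Φ ih =>
    rintro ⟨hconf, -⟩
    obtain ⟨f, a⟩ := e
    rw [coins_cons, ih hconf]
    have hPa : boardPotential ℓ ((f, a) :: Φ) = boardPotential ℓ ((f, false) :: Φ) := by
      unfold boardPotential; rw [boardSpan_cons_eq f a false]
    have hsteps := boardPotential_cons_le hℓ (f, false) Φ
    by_cases hP : boardPotential ℓ ((f, false) :: Φ) = boardPotential ℓ Φ + 1
    · have : bphpDelayer ℓ Φ f = none := by unfold bphpDelayer; simp [hP]
      simp only [this, if_true]
      rw [hPa, hP]
    · have : bphpDelayer ℓ Φ f ≠ none := by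
        unfold bphpDelayer; simp only [hP, if_false]; split_ifs <;> simp
      simp only [this, if_false, add_zero]
      rw [hPa]
      omega

/-- **Lemma 5.7** [Efremenko–Garlík–Itsykson 2024]: a locally consistent board contradicts no clause
of `BPHPᵐ_{2^ℓ}` (`ℓ ≥ 3`): two closure pigeons sit in different holes, and a pigeon outside the
closure can be moved off any hole by flipping a non-pivot bit. [cite: EfremenkoGarlikItsykson2024, Lemma 5.7] -/
theorem not_contradicts_of_locConsistent (hℓ : 3 ≤ ℓ) {m : ℕ} {Φ : List LinLit}
    (hΦ : LocConsistent ℓ Φ) {c : Clause ℕ} (hc : c ∈ bphpCNF m ℓ) :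
    ¬ Contradicts Φ (Clause.toLinClause c) := by
  classical
  obtain ⟨σ, hσΦ, hinj⟩ := hΦ
  obtain ⟨p, hfree⟩ := exists_blockFree_canClosure (by omega : 0 < ℓ) Φ.toFinset
  have hσF : ∀ e ∈ Φ.toFinset, LinLit.eval σ e = true := fun e he => hσΦ e (List.mem_toFinset.1 he)
  obtain ⟨x, y, hxy, S, rfl⟩ := exists_of_mem_bphpCNF hc
  -- a solution of the board satisfying the clause
  have key : ∃ σ' : ℕ → Bool, (∀ e ∈ Φ.toFinset, LinLit.eval σ' e = true) ∧
      (Clause.toLinClause (bphpBlockClause ℓ x S ++ bphpBlockClause ℓ y S)).eval σ' = true := by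
    by_cases hx : x ∈ boardClosure ℓ Φ
    · by_cases hy : y ∈ boardClosure ℓ Φ
      · exact ⟨σ, hσF, eval_bphpClause_of_holeOf_ne
          (fun h => hxy (hinj (Finset.mem_coe.2 hx) (Finset.mem_coe.2 hy) h)) S⟩
      · obtain ⟨σ', hσ', hne⟩ := exists_sol_holeOf_ne hℓ hfree hσF (Ne.symm hxy) hy
        exact ⟨σ', hσ', eval_bphpClause_of_holeOf_ne (Ne.symm hne) S⟩
    · obtain ⟨σ', hσ', hne⟩ := exists_sol_holeOf_ne hℓ hfree hσF hxy hx
      exact ⟨σ', hσ', eval_bphpClause_of_holeOf_ne hne S⟩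
  obtain ⟨σ', hσ', hsat⟩ := key
  intro hcontra
  have := hcontra σ' fun e he => hσ' e (List.mem_toFinset.2 he)
  rw [this] at hsat
  exact Bool.false_ne_true hsat

/-- **The Delayer guarantees `2^{ℓ−2} + 1` coins on `BPHPᵐ_{2^ℓ}`** (`ℓ ≥ 3`): when a conforming board
contradicts a clause it is not locally consistent, so its closure has more than `2^{ℓ−2}` pigeons, and
coins = potential ≥ |closure|. [Efremenko–Garlík–Itsykson 2024, Thm 5.8 (proof: "at the time Delayer
gives up, he has earned at least `2^{ℓ−2}` coins")] [cite: EfremenkoGarlikItsykson2024, Theorem 5.8] -/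
theorem guarantees_bphpDelayer (hℓ : 3 ≤ ℓ) (m : ℕ) :
    Guarantees (bphpCNF m ℓ) (bphpDelayer ℓ) (2 ^ (ℓ - 2) + 1) := by
  have hℓ0 : 0 < ℓ := by omega
  intro Φ hconf hend
  obtain ⟨c, hc, hcontra⟩ := hend
  have hnot : ¬ LocConsistent ℓ Φ := fun h => not_contradicts_of_locConsistent hℓ h hc hcontra
  have hbig : ¬ (boardClosure ℓ Φ).card ≤ 2 ^ (ℓ - 2) := fun h =>
    hnot (locConsistent_of_conform (by omega) Φ hconf h)
  rw [coins_eq_boardPotential hℓ0 Φ hconf]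
  have := card_canClosure_le_clPotential (ℓ := ℓ) (W := boardSpan Φ)
  unfold boardPotential
  unfold boardClosure at hbig
  omega

end BPHPGame

/-! ### Theorem 5.8 -/

/-- **Efremenko–Garlík–Itsykson 2024, Theorem 5.8 (tree-like Res(⊕) size of the binary pigeonhole
principle).** For `ℓ ≥ 3` and every `m`, every TREE-LIKE Res(⊕) refutation (resolution rule +
semantic weakening; every line used as a premise at most once) of `BPHPᵐ_{2^ℓ} = bphpCNF m ℓ` has at
least `2^(2^(ℓ-2) + 1)` lines — i.e. `≥ 2^{n/4 + 1}` for `n = 2^ℓ` holes (print: `2^{n/4}`).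
[cite: EfremenkoGarlikItsykson2024, Theorem 5.8] -/
theorem two_pow_le_length_bphp_treeLike {ℓ : ℕ} (hℓ : 3 ≤ ℓ) (m : ℕ) {π : List ResLinLine}
    (hπ : IsResLinRefutation (bphpCNF m ℓ) π)
    (htree : ∀ i : ℕ, (π.map fun l => l.premises.count i).sum ≤ 1) :
    2 ^ (2 ^ (ℓ - 2) + 1) ≤ π.length :=
  ProverDelayer.two_pow_le_length_of_guarantees (guarantees_bphpDelayer hℓ m) hπ htree

/-- The printed form `2^{n/4} = 2^{2^{ℓ−2}}`. [Efremenko–Garlík–Itsykson 2024, Thm 5.8]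
[cite: EfremenkoGarlikItsykson2024, Theorem 5.8] -/
theorem two_pow_quarter_le_length_bphp_treeLike {ℓ : ℕ} (hℓ : 3 ≤ ℓ) (m : ℕ) {π : List ResLinLine}
    (hπ : IsResLinRefutation (bphpCNF m ℓ) π)
    (htree : ∀ i : ℕ, (π.map fun l => l.premises.count i).sum ≤ 1) :
    2 ^ (2 ^ (ℓ - 2)) ≤ π.length :=
  (Nat.pow_le_pow_right (by norm_num) (Nat.le_succ _)).trans (two_pow_le_length_bphp_treeLike hℓ m hπ htree)

/-- Non-vacuity: for `ℓ ≥ 3` and `m > 2^ℓ` (unsatisfiable `BPHP`) tree-like refutations exist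
(`ResLinTreeLikeCompleteness`) and every one has at least `2^{n/4 + 1}` lines.
[Efremenko–Garlík–Itsykson 2024, Thm 5.8; folklore completeness] [cite: EfremenkoGarlikItsykson2024, Theorem 5.8] -/
theorem exists_treeLike_and_two_pow_le_length_bphp {ℓ m : ℕ} (hℓ : 3 ≤ ℓ) (hm : 2 ^ ℓ < m) :
    (∃ π : List ResLinLine, IsResLinRefutation (bphpCNF m ℓ) π ∧
      ∀ i : ℕ, (π.map fun l => l.premises.count i).sum ≤ 1) ∧
    ∀ π : List ResLinLine, IsResLinRefutation (bphpCNF m ℓ) π →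
      (∀ i : ℕ, (π.map fun l => l.premises.count i).sum ≤ 1) → 2 ^ (2 ^ (ℓ - 2) + 1) ≤ π.length := by
  refine ⟨?_, fun π hπ htree => two_pow_le_length_bphp_treeLike hℓ m hπ htree⟩
  obtain ⟨π, hπ, htree, -⟩ :=
    exists_treeLike_isResLinRefutation_card (bphpCNF_not_satisfiable hm)
  exact ⟨π, hπ, htree⟩

end Literature.Computability.MetaComplexity
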